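import Mathlib.LinearAlgebra.Matrix.NonsingularInverse
import Mathlib.LinearAlgebra.Matrix.Kronecker
import Mathlib.LinearAlgebra.Matrix.GeneralLinearGroup.Defs
import Mathlib.Logic.Equiv.Fin.Basic
import Mathlib.Tactic.Module
import HarnessLib

/-!
# The torus twist `M_V = [[p₂, q₂ 𝕋],[d q₂ 𝕋⁻¹, p₂]]` as an invertible matrix, and its determinant `N(V)ⁿ`

Topic `NumberTheory/Automorphic`; namespace `Literature.NumberTheory.Automorphic.UnitaryGroup`.  KERNEL mathematics only:
theorems (no `def`, no named fact, no instance, no `sorry`); Mathlib-only imports (companion of ★ `QuadraticHermitianNormSplitTorus`).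

THE MATHEMATICS ([Weil1964] Chap. I n° 13 p. 160: the Levi element `d₀(α)` acts by `Φ ↦ Φ ∘ α` and its module is
`|det α|`; [GelbartRogawski1991] §3.1 p. 455: the `E`-scalars act on `Res_{E/F}(V ⊗ W)`).  Over a commutative ring `R`
with `𝕋 ∈ M_n(R)` invertible, the matrix of «multiplication by the scalar `V = p₂ + q₂δ`» (`δ² = d`) in the Darboux
coordinates of the doubled carrier, in the `twist` convention `x ↦ x ᵥ* M` of ★ `Weil1964/AdelicDoublingGeometricFrameBorel`
(L-D) ∕ ★ `…FrameBorelMp` (J-D), is `M(p₂, q₂) = reindex (fromBlocks (p₂•1) (q₂•𝕋) ((d q₂)•𝕋⁻¹) (p₂•1))`: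
* `torusTwist_mul` — **`M(p₂, q₂) · M(p₂′, q₂′) = M(p₂p₂′ + d q₂q₂′, p₂q₂′ + q₂p₂′)`** (multiplicativity: `M_V M_{V′} = M_{VV′}`);
* `exists_torusTwistGL` — for `p₂p₂′ + d q₂q₂′ = 1`, `p₂q₂′ + q₂p₂′ = 0` (i.e. `V V′ = 1`) an element `Mt ∈ GL_{n+n}(R)` with
  `↑Mt = M(p₂, q₂)`, `↑Mt⁻¹ = M(p₂′, q₂′)` — the `(Mt, hMt)` binder of the (J-D)∕(hLD-grp) letters, BUILT;
* `det_torusTwist` — **`det M(p₂, q₂) = (p₂² − d q₂²)ⁿ = N(V)ⁿ`** (any `p₂, q₂`, no invertibility assumed: conjugate by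
  `1 ⊕ 𝕋` to scalar blocks, which are a Kronecker product with `!![p₂, q₂; d q₂, p₂]`, ★ Mathlib `det_kronecker`).

USE (cell `hodgecm-mathlib`, FLOOR-0 P4, ENGINE E-2, I-CLOSE (S-1) `hbd_CM`, binder `hLD`): the one-place torus package takes
`(p₂, q₂) = (re, im)` of an idele class scalar supported at one place; `det = N(V)ⁿ` gives `adelicAbsDet Mt = |N(V)|_𝔸ⁿ = |s|_v^{∓n}`.
HC_CM is proved only modulo the printed citations until rung 0 closes.

## References
* [Weil1964] A. Weil, *Sur certains groupes d'opérateurs unitaires*, Acta Math. 111 (1964), Chap. I n° 13 p. 160.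
* [GelbartRogawski1991] S. Gelbart, J. Rogawski, Invent. Math. 105 (1991), §3.1 pp. 454–455.
-/

set_option autoImplicit false

namespace Literature.NumberTheory.Automorphic

namespace UnitaryGroup

open Matrix
open scoped Kronecker MatrixGroups

variable {R : Type*} [CommRing R] {n : ℕ}

/-- reindexing square matrices along an equivalence is multiplicative. [folklore] -/
private theorem reindex_mul_reindex' {ι κ : Type*} [Fintype ι] [Fintype κ] [DecidableEq ι] [DecidableEq κ] (e : κ ≃ ι)
    (A B : Matrix κ κ R) : Matrix.reindex e e A * Matrix.reindex e e B = Matrix.reindex e e (A * B) := by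
  rw [Matrix.reindex_apply, Matrix.reindex_apply, Matrix.reindex_apply, Matrix.submatrix_mul_equiv]

/-- **MULTIPLICATIVITY OF THE TORUS TWIST**: `M(p₂, q₂) · M(p₂′, q₂′) = M(p₂p₂′ + d q₂q₂′, p₂q₂′ + q₂p₂′)` — the matrix of
`V ↦ M_V` is multiplicative (`(p₂ + q₂δ)(p₂′ + q₂′δ) = (p₂p₂′ + d q₂q₂′) + (p₂q₂′ + q₂p₂′)δ`). [cite: GelbartRogawski1991, §3.1 p. 455] -/
theorem torusTwist_mul (𝕋 : Matrix (Fin n) (Fin n) R) (h𝕋 : IsUnit 𝕋.det) (d p₂ q₂ p₂' q₂' : R) :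
    Matrix.reindex finSumFinEquiv finSumFinEquiv
        (Matrix.fromBlocks (p₂ • (1 : Matrix (Fin n) (Fin n) R)) (q₂ • 𝕋) ((d * q₂) • 𝕋⁻¹) (p₂ • 1)) *
      Matrix.reindex finSumFinEquiv finSumFinEquiv
        (Matrix.fromBlocks (p₂' • (1 : Matrix (Fin n) (Fin n) R)) (q₂' • 𝕋) ((d * q₂') • 𝕋⁻¹) (p₂' • 1)) =
      Matrix.reindex finSumFinEquiv finSumFinEquiv
        (Matrix.fromBlocks ((p₂ * p₂' + d * (q₂ * q₂')) • (1 : Matrix (Fin n) (Fin n) R)) ((p₂ * q₂' + q₂ * p₂') • 𝕋)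
          ((d * (p₂ * q₂' + q₂ * p₂')) • 𝕋⁻¹) ((p₂ * p₂' + d * (q₂ * q₂')) • 1)) := by
  rw [reindex_mul_reindex', Matrix.fromBlocks_multiply]
  have h1 : 𝕋 * 𝕋⁻¹ = 1 := Matrix.mul_nonsing_inv 𝕋 h𝕋
  have h2 : 𝕋⁻¹ * 𝕋 = 1 := Matrix.nonsing_inv_mul 𝕋 h𝕋
  congr 1
  simp only [Matrix.smul_mul, Matrix.mul_smul, Matrix.one_mul, Matrix.mul_one, smul_smul, h1, h2]
  refine Matrix.fromBlocks_inj.2 ⟨?_, ?_, ?_, ?_⟩ <;> module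

/-- **THE TORUS TWIST AS AN ELEMENT OF `GL_{n+n}(R)`**: for `V V′ = 1` in coordinates (`p₂p₂′ + d q₂q₂′ = 1`,
`p₂q₂′ + q₂p₂′ = 0`) the matrix `M(p₂, q₂)` is invertible with inverse `M(p₂′, q₂′)` — the `(Mt, hMt)` binder of the torus
letters, built. [cite: Weil1964, Chap. I n° 13 p. 160] -/
theorem exists_torusTwistGL (𝕋 : Matrix (Fin n) (Fin n) R) (h𝕋 : IsUnit 𝕋.det) {d p₂ q₂ p₂' q₂' : R}
    (h1 : p₂ * p₂' + d * (q₂ * q₂') = 1) (h2 : p₂ * q₂' + q₂ * p₂' = 0) :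
    ∃ Mt : GL (Fin (n + n)) R,
      (Mt : Matrix (Fin (n + n)) (Fin (n + n)) R) =
          Matrix.reindex finSumFinEquiv finSumFinEquiv
            (Matrix.fromBlocks (p₂ • (1 : Matrix (Fin n) (Fin n) R)) (q₂ • 𝕋) ((d * q₂) • 𝕋⁻¹) (p₂ • 1)) ∧
      ((Mt⁻¹ : GL (Fin (n + n)) R) : Matrix (Fin (n + n)) (Fin (n + n)) R) =
          Matrix.reindex finSumFinEquiv finSumFinEquiv
            (Matrix.fromBlocks (p₂' • (1 : Matrix (Fin n) (Fin n) R)) (q₂' • 𝕋) ((d * q₂') • 𝕋⁻¹) (p₂' • 1)) := by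
  have h1' : p₂' * p₂ + d * (q₂' * q₂) = 1 := by rw [mul_comm p₂', mul_comm q₂']; exact h1
  have h2' : p₂' * q₂ + q₂' * p₂ = 0 := by rw [mul_comm p₂', mul_comm q₂', add_comm]; exact h2
  have hone : Matrix.reindex finSumFinEquiv finSumFinEquiv
      (Matrix.fromBlocks (1 : Matrix (Fin n) (Fin n) R) ((0 : R) • 𝕋) ((d * 0) • 𝕋⁻¹) 1) =
        (1 : Matrix (Fin (n + n)) (Fin (n + n)) R) := by
    rw [zero_smul, mul_zero, zero_smul, Matrix.fromBlocks_one, Matrix.reindex_apply, Matrix.submatrix_one_equiv]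
  have hmul := torusTwist_mul 𝕋 h𝕋 d p₂ q₂ p₂' q₂'
  rw [h1, h2, one_smul, hone] at hmul
  have hmul' := torusTwist_mul 𝕋 h𝕋 d p₂' q₂' p₂ q₂
  rw [h1', h2', one_smul, hone] at hmul'
  exact ⟨⟨_, _, hmul, hmul'⟩, rfl, rfl⟩

/-- conjugating the torus twist by `1 ⊕ 𝕋` turns it into SCALAR blocks: `[[p,q𝕋],[dq𝕋⁻¹,p]] = (1 ⊕ 𝕋⁻¹)[[p,q],[dq,p]](1 ⊕ 𝕋)`
(blockwise). [folklore] -/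
private theorem fromBlocks_torus_eq_conj (𝕋 : Matrix (Fin n) (Fin n) R) (h𝕋 : IsUnit 𝕋.det) (d p₂ q₂ : R) :
    Matrix.fromBlocks (p₂ • (1 : Matrix (Fin n) (Fin n) R)) (q₂ • 𝕋) ((d * q₂) • 𝕋⁻¹) (p₂ • 1) =
      Matrix.fromBlocks (1 : Matrix (Fin n) (Fin n) R) 0 0 𝕋⁻¹ *
        Matrix.fromBlocks (p₂ • (1 : Matrix (Fin n) (Fin n) R)) (q₂ • 1) ((d * q₂) • 1) (p₂ • 1) *
        Matrix.fromBlocks (1 : Matrix (Fin n) (Fin n) R) 0 0 𝕋 := by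
  have h2 : 𝕋⁻¹ * 𝕋 = 1 := Matrix.nonsing_inv_mul 𝕋 h𝕋
  rw [Matrix.fromBlocks_multiply, Matrix.fromBlocks_multiply]
  simp only [Matrix.mul_one, Matrix.mul_zero, smul_zero, add_zero, zero_add, Matrix.mul_smul, Matrix.smul_mul,
    Matrix.one_mul, h2]

/-- the scalar-block matrix `[[p,q],[dq,p]] ⊗ 1ₙ` is the Kronecker product, reindexed. [folklore] -/
private theorem fromBlocks_scalar_eq_reindex_kronecker (d p₂ q₂ : R) :
    Matrix.fromBlocks (p₂ • (1 : Matrix (Fin n) (Fin n) R)) (q₂ • 1) ((d * q₂) • 1) (p₂ • 1) =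
      Matrix.reindex ((finTwoEquiv.prodCongr (Equiv.refl (Fin n))).trans (Equiv.boolProdEquivSum (Fin n)))
        ((finTwoEquiv.prodCongr (Equiv.refl (Fin n))).trans (Equiv.boolProdEquivSum (Fin n)))
        ((!![p₂, q₂; d * q₂, p₂] : Matrix (Fin 2) (Fin 2) R) ⊗ₖ (1 : Matrix (Fin n) (Fin n) R)) := by
  ext i j
  rcases i with i | i <;> rcases j with j | j <;>
    simp [Matrix.fromBlocks, Matrix.reindex_apply, Matrix.submatrix_apply, Matrix.kroneckerMap_apply,
      Equiv.boolProdEquivSum, finTwoEquiv, Matrix.one_apply, Matrix.smul_apply]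

/-- **THE DETERMINANT OF THE TORUS TWIST IS `N(V)ⁿ`**: `det M(p₂, q₂) = (p₂² − d q₂²)ⁿ` for every `p₂, q₂ ∈ R` (no
invertibility of `p₂` needed) — Weil's module of `d₀(α)` is `|det α|`, here `|N_{E∕F}(V)|ⁿ`. [cite: Weil1964, Chap. I n° 13 p. 160] -/
theorem det_torusTwist (𝕋 : Matrix (Fin n) (Fin n) R) (h𝕋 : IsUnit 𝕋.det) (d p₂ q₂ : R) :
    (Matrix.reindex finSumFinEquiv finSumFinEquiv
        (Matrix.fromBlocks (p₂ • (1 : Matrix (Fin n) (Fin n) R)) (q₂ • 𝕋) ((d * q₂) • 𝕋⁻¹) (p₂ • 1))).det =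
      (p₂ * p₂ - d * (q₂ * q₂)) ^ n := by
  rw [Matrix.det_reindex_self, fromBlocks_torus_eq_conj 𝕋 h𝕋 d p₂ q₂, Matrix.det_mul, Matrix.det_mul,
    Matrix.det_fromBlocks_zero₂₁, Matrix.det_fromBlocks_zero₂₁, Matrix.det_one, one_mul, one_mul,
    fromBlocks_scalar_eq_reindex_kronecker, Matrix.det_reindex_self, Matrix.det_kronecker, Matrix.det_one, one_pow,
    mul_one, Matrix.det_fin_two_of, Fintype.card_fin]
  rw [mul_comm, ← mul_assoc, ← Matrix.det_mul, Matrix.mul_nonsing_inv 𝕋 h𝕋, Matrix.det_one, one_mul]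
  ring

end UnitaryGroup

end Literature.NumberTheory.Automorphic
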